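import Literature.Barriers.RiemannHypothesis.BeurlingCounterexamplesHolds
import HarnessLib

/-!
# Counting-type prime data on a finite window: the «PRIME-WINDOW BLINDNESS» barrier record (B33)

A BARRIER RECORD of the rh-split cell (LADDER-RH criterion search), RH-free and `ζ`-free: an INSTRUMENT,
not a route; every statement below is either discharged from the tree (`_holds`) or recorded in prose
with its locator and status.  It cites the kernel objects BY NAME and restates nothing.  Toward the
Riemann Hypothesis: 0 (no exponent moves); nothing here bears on the truth of RH.

## The barrier sentence (B33, letter of record: rh-split-lead RULING #468; theory text CANDIDATES §25.11 (I)(2c))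

For every lattice step `h > 0`, width `σ* ∈ (0,1)`, thin exponent `e > 0`, every prime window `U ≥ 0`
and every precision `ε > 0` there is a screw-lattice tower configuration `Z` satisfying the twelve
thin-blind clauses of B26 VERBATIM (`ScrewLatticeTower.ThinBlindClauses h σ* e Z`) and simultaneously
`|Ψ_Z(t)| ≤ ε` for all `|t| ≤ U` (`ScrewLatticeTower.PrimeWindowSmall U ε Z`):
`ScrewLatticeTower.primeWindowBlindModel_holds : ScrewLatticeTower.PrimeWindowBlindModel`
(`Theorems/Splittings/PrimeWindowBlindModel.lean`; footprint lemmas `PrimeWindowFootprint.lean`; class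
file `PrimeWindowBlindnessClass.lean`).  Consequently every functional of the zeros that is of lattice
class C AND sup-norm-continuous in the prime data on a finite window at a precision `ε > 0` — class
`ScrewLatticeTower.ClassCP h U ε` ⊇ `ClassC h` (`classCP_of_classC`) — is BLIND to thin capped towers:
`classCP_blind_to_tower'`, `not_criterion_of_classCP'` (unconditional).  Neither an emptiness criterion
nor an attained-supremum criterion for RH can be built from COUNTING-TYPE prime data on a finite window
plus class-C zero statistics.  Kernel RECORD form (Summits side, this file's companion `Theorems/Splittings/PrimeWindowBlindnessBarrierHolds.lean`):
`PrimeWindowBlindnessBarrier.CountingTypePrimeDataBlind` / `countingTypePrimeDataBlind_holds` /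
`CountingTypePrimeDataBlind.not_criterion` — the gate keeps Summits imports out of `Literature/`, so the
kernel sentences are recorded there and this file holds the PUBLISHED shadow and the map.

RIDERS. (r1) The footprint bound `8 e^{σ* U} Σ m/γ²` is classical invisibility of high zeros below
`X = e^U`; the content is SIMULTANEITY with B26's lattice clauses under the `M`-dilation.  (r2) «continuous
at that precision» = sup-norm-continuous functionals on the window; exact / integrality readers are
`ε = 0` objects and belong to the layer Q_C below, not to B33.  PRECISION (§25.12): counting-type prime
data cap SEPARATED towers exactly at the density-hypothesis line `e = 2(1 − β)` and no lower.

## Relations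

* B26 ⊂ B33: `classCP_of_classC` (a class-C criterion ignores the window); B26's own record is
  `ScrewLatticeTower.classC_blind_to_tower` / `not_criterion_of_classC` / `exists_tower_thin_blind_model`
  (`Theorems/Splittings/ScrewLatticeTowerClassC.lean`, `…TowerThin.lean`).  Kernel form of the inclusion:
  `PrimeWindowBlindnessBarrier.CountingTypePrimeDataBlind.of_classC` (companion file).
* B33 ⟂ B32 «PRIME-CELL BLINDNESS» (the prime-side twin, `Theorems/Splittings/ScrewPrimeCellBlindness{A,B,C,}.lean`:
  `ScrewPrimeCellBlindness.primeSumW_eq_moments`, `…latticeCeilingW_add_tentFamily_iff`,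
  `…primeSumW_add_tentFamily_left_ge`, PIN `…abs_primeSumW_sub_le_of_samples_eq`, exchange rate
  `…abs_screwW_sub_zetaScrew_le_mul_primeSum`): instrument-compatible, NOT a joint barrier theorem.
* Splitting bookkeeping: a tower-killing conjunct and the strip form it buys are related abstractly in
  `Theorems/Splittings/TowerKillerStrip.lean` (`TowerKillerStrip.towerKiller_implies_strip`).

## The exact layer Q_C (`ε = 0`, finite `X`, without multiplicativity) — three clauses of record

1. REMOVAL-ONLY exact theft — NO (Krein necessity; candidate `KreinFailsFinite`, size M): an OPEN typed
   candidate, NOT in the tree; not asserted here.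
2. SLIDING-ONLY theft — NO, IN THE TREE («COUNT THEFT LAW», `t → 0` germ, ONE-SIDED kernel form: net stolen
   (slid-away) count below `Y` ≥ (43/24)·(tower weight below `Y`) − O(A·η̄·log Y) − O(σ*²·A_Z) —
   `SlidingGerm.count_theft_law`, `SlidingGerm.unresolved_weight_le_of_boundedSlidingTheft`; the two-sided
   exchange «removed = 2N_Z(Y) + O(log Y)» is rh-splitx-theory-1's paper form K7-COUNT-LAW-2SIDED, NOT in
   the tree): termwise/abstract layer `SlidingGerm.count_theft_law`,
   `SlidingGerm.no_superlog_tower_of_pure_sliding` (`Theorems/Splittings/SlidingGerm.lean`); summed layer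
   `SlidingGerm.not_boundedSlidingTheft_of_superlogTower` (`…/SlidingTheftGerm.lean`, hypotheses
   `CountHyp` / `GermHyp` carried as hypotheses); firing instance on an inhabited genuine off-line tower
   `SlidingGerm.not_boundedSlidingTheft_towerConfig` (`…/SlidingTheftGermTower.lean`).  Kernel record:
   `PrimeWindowBlindnessBarrier.SlidingOnlyTheftNoGo` / `slidingOnlyTheftNoGo_holds` (companion file).
3. REMOVAL of `2m_j` true zeros per atom + BALANCED SLIDING with redundancy `≥ 3` — NO OBSTRUCTION FOUND,
   conjecturally YES (typed conjecture `RemovalSlideTheft`, construction plan §25.15 L1–L5, never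
   staffed; the naive critical-density synthesis provably fails, far slides ∝ height): OPEN; not asserted.

## Catalogue sentence (§25.11 (III) as amended)

«Q_B (`X = ∞`, with multiplicativity): YES for every `θ > ½` — thick: Broucke–Debruyne 2023 §6
[cite: BrouckeDebruyne2023, §6, arXiv pp. 15–16]; counting-side shadow IN THE TREE:
`BrouckeDebruyneRevesz2023_thm11_holds` ([α, β]-systems for all `α ∈ [0,1)`, `β ∈ [½,1)`,
[cite: BrouckeDebruyneRevesz2023, Theorem 1.1]), specialised below to `α > ½` as
`offCritical_wellBehaved_systems_exist`; zero-side statement typed below as the NAMED FACT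
`BrouckeDebruyne2023_sec6` (not proved here); thin: the onset template / finite rung of route items
[24867] / [24939].  B33 (`ε > 0`, `X < ∞`): blind, KERNEL.  Q_C (`ε = 0`, `X < ∞`): the three clauses.
Hence the prime side's teeth against capped towers, if any, are ℤ-SPECIFIC AND EXACT.»

Broucke–Debruyne 2023 §6 as printed (Acta Arith. 207, «Sharpness of the zero-density theorem»;
[cite: BrouckeDebruyne2023, §6, arXiv pp. 15–16]): for `½ < θ < β < 1` and `ε > 0` there is a (discrete) Beurling system `𝒫_{β,θ,ε}` with
(i) `N(β, T) ≫ T^{(1−β)(1−ε)/(1+β−2θ)}` for `T ≥ T₀(β, ε)` and no zeta zeros in `Re s > β`, (ii)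
`N(σ, T) ≫ T^{(1+β−2σ)(1−ε)/(1+β−2θ)}` for `θ < σ < β`, `T ≥ T₀`, (iii) `N(x) = Ax + O(x^θ e^{C√log x})`,
`A > 0` (continuous template; the discrete system «with a slightly worse error term», p. 16) — a CAPPED
TOWER on `Re s = β` coexisting with `θ`-well-behaved integers.
Typed below (`BrouckeDebruyne2023_sec6`) with `N(σ, T)` spelled out as the cardinality of the zero set of
an analytic continuation `Z` of `ζ_𝒫` to `{θ < Re s} ∖ {1}` (tree vocabulary `BeurlingPrimes.zeta`,
`BeurlingPrimes.intCount` of `BeurlingCounterexamples.lean`); implied constants are allowed to depend on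
all parameters and the discrete integer error is `O(x^{θ'})` for every `θ' > θ` (weakest printed reading,
rh-splitx-theory-1 wording read 04:34:59Z MUST-2).

HONEST LABEL: SPLITTING SEARCH over kernel-typed RH-EQUIVALENCES; a splitting `A ∧ B ⟹ RH` is CONDITIONAL
bookkeeping unless `A` and `B` are both proved; this file is a barrier record (instrument), RH-free, 0 in
the exponent; nothing here bears on the truth of RH.

## References

* [BrouckeDebruyneRevesz2023] F. Broucke, G. Debruyne, Sz. Gy. Révész, *Some examples of well-behaved
  Beurling number systems*, arXiv:2309.01567 (2023), Theorem 1.1 (held; typed and PROVED in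
  `Literature/Barriers/RiemannHypothesis/BeurlingCounterexamples*.lean`).
* [BrouckeDebruyne2023] F. Broucke, G. Debruyne, *On zero-density estimates and the PNT in short intervals
  for Beurling generalized numbers*, Acta Arith. 207 (2023) 365–391, doi:10.4064/aa221223-15-2,
  arXiv:2211.08716, §6 pp. 15–16 (held: corpus `paper:arxiv-2211.08716`; §6 read for this record).
* rh-split cell records: lead RULING #468 (B33 mint), rh-splitx-theory-1 CANDIDATES §25.11–25.15, 25.21–25.22.
-/

noncomputable section

namespace Literature.Barriers.RiemannHypothesis

open Complex

/-- **Broucke–Debruyne 2023, §6 «Sharpness of the zero-density theorem»** (NAMED FACT, not proved here).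
As printed: "We shall provide a Beurling system `𝒫_{β,θ,ε}`, `1/2 < θ < β < 1`, `ε > 0` having the
following properties: • there exists `T₀ = T₀(β,ε)` such that `N(β, T) ≫ T^{(1−β)(1−ε)/(1+β−2θ)}` for
`T ≥ T₀` and `ζ` has no zeros on the half-plane `Re s > β`, • `N(σ, T) ≫ T^{(1+β−2σ)(1−ε)/(1+β−2θ)}`,
for `θ < σ < β` and `T ≥ T₀`, • there exists `A = A(β,ε) > 0` such that
`N(x) = A x + O_{ε,β}(x^θ exp(C√log x))`, for a suitable constant `C > 0`" (continuous template à la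
Diamond–Montgomery–Vorhauer, then "a discrete Beurling system … inherits all the properties … as long
as `θ > 1/2`").  Vendored for the DISCRETE system `P : BeurlingPrimes` in the tree's vocabulary, at the WEAKEST
printed reading (p. 16: the discrete system "inherits all the properties analyzed above from the
continuous system, possibly with a different value for `A` and a slightly worse error term in the
asymptotics for `N`"): (iii) is recorded as `N_𝒫(x) = Ax + O_{θ'}(x^{θ'})` for EVERY `θ' > θ` (global on
`x ≥ 1`, equivalent to the asymptotic bound), not with the continuous template's `x^θ e^{C√log x}`;
(i) survives discretisation because `ζ_D = ζ·F` with `F = exp(analytic)` zero-free on `Re s > ½ + ε₁`,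
`ε₁ < θ − ½` (p. 16); `N(σ, T)` is the number of zeros `ρ ≠ 1` of an analytic continuation `Z` of `ζ_𝒫`
(`BeurlingPrimes.zeta`) to `{θ < Re s} ∖ {1}` with `Re ρ ≥ σ`, `|Im ρ| ≤ T`, as a `Set.ncard` — zeros
counted WITHOUT multiplicity (distinct by construction, p. 15: `ρ_k = β + iγ_k`), formally the stronger
reading of a lower bound, and a true finite count here (isolated zeros, none right of `β`, compact
region); `≫` is read with constants depending on all parameters (for (ii) also on `σ`).  A CAPPED
TOWER: positive-density zeros ON `Re s = β < 1` with none beyond, next to `θ`-well-behaved integers.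
-- TODO(general form): the continuous template's error `x^θ e^{C√log x}`; uniformity of constants in `σ`.
[cite: BrouckeDebruyne2023, §6, arXiv pp. 15–16] -/
def BrouckeDebruyne2023_sec6 : Prop :=
  ∀ θ β ε : ℝ, 1 / 2 < θ → θ < β → β < 1 → 0 < ε →
    ∃ (P : BeurlingPrimes) (Z : ℂ → ℂ) (A T₀ : ℝ), 0 < A ∧
      (∀ θ' : ℝ, θ < θ' → ∃ K : ℝ, ∀ x : ℝ, 1 ≤ x → |(P.intCount x : ℝ) - A * x| ≤ K * x ^ θ') ∧
      (∀ s : ℂ, 1 < s.re → Z s = P.zeta s) ∧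
      DifferentiableOn ℂ Z {s : ℂ | θ < s.re ∧ s ≠ 1} ∧
      (∀ s : ℂ, β < s.re → s ≠ 1 → Z s ≠ 0) ∧
      (∃ c : ℝ, 0 < c ∧ ∀ T : ℝ, T₀ ≤ T →
        c * T ^ ((1 - β) * (1 - ε) / (1 + β - 2 * θ)) ≤
          ({s : ℂ | Z s = 0 ∧ β ≤ s.re ∧ s ≠ 1 ∧ |s.im| ≤ T} : Set ℂ).ncard) ∧
      (∀ σ : ℝ, θ < σ → σ < β → ∃ c : ℝ, 0 < c ∧ ∀ T : ℝ, T₀ ≤ T →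
        c * T ^ ((1 + β - 2 * σ) * (1 - ε) / (1 + β - 2 * θ)) ≤
          ({s : ℂ | Z s = 0 ∧ σ ≤ s.re ∧ s ≠ 1 ∧ |s.im| ≤ T} : Set ℂ).ncard)

/-- **Q_B, counting-side shadow in the tree** (Broucke–Debruyne–Révész 2023, Theorem 1.1, specialised to
prime-error exponents beyond the critical line): for every `α ∈ (½, 1)` and `β ∈ [½, 1)` there is a
Beurling generalized prime system that is an `[α, β]`-system (`BeurlingPrimes.IsSystem α β`: prime error
of exact exponent `α`, integer error of exact exponent `β`) — well-behaved integers do NOT exclude prime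
errors of exponent `> ½` (hence, by Landau's method, continued-zeta zeros beyond `Re s = ½`).  PROVED:
`BrouckeDebruyneRevesz2023_thm11_holds`. [cite: BrouckeDebruyneRevesz2023, Theorem 1.1] -/
theorem offCritical_wellBehaved_systems_exist :
    ∀ α β : ℝ, 1 / 2 < α → α < 1 → 1 / 2 ≤ β → β < 1 → ∃ P : BeurlingPrimes, P.IsSystem α β :=
  fun α β hα hα1 hβ hβ1 ↦ BrouckeDebruyneRevesz2023_thm11_holds α β (by linarith) hα1 hβ hβ1

end Literature.Barriers.RiemannHypothesis

end
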